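import Summits.SmoothPoincare4.SmoothPoincare4.Theorems.RootDecompAEDoublesShadowLEOnePeelRecursion

/-!
# `stub_peelCertificates : PeelCertificates` — the peeling theorem for KMN encoding graphs

This file closes, BY NAME, the registered LOAD-BEARING stub

  `theorem stub_peelCertificates : PeelCertificates`

of the line `grade_one_ac` (`Summits/SmoothPoincare4/SmoothPoincare4/Cruxes/DoublesShadowLEOne/Lines/grade_one_ac.lean`,
namespace `Summit.SmoothPoincare4.SmoothPoincare4.Cruxes.DoublesShadowLEOne.GradeOneAC`, §7) on the crux
`RootDecompAE.DoublesShadowLEOne` (item `stmt-SmoothPoincare4-32181`).  In the skeleton, `gradeOneAC_of` derives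
`GradeOneAC` (uniform presentations of admissible KMN encoding graphs presenting the trivial group are Andrews–Curtis
trivial) from `PeelCertificates` and the proved certificate-format lemma `acTrivial_of_peelCertificates` (§6.2);
`PeelCertificates` is the one open combinatorial statement of that line.

WHAT IS PROVED.  For every admissible encoding graph `G` (valid ports, no port glued twice, the tree edges form a
spanning tree) and all index bijections `eg`, `er`: if `P(G) = G.presentation eg er` presents the trivial group, then
there are a permutation `σ` (generator `i` ↦ its owner relator `σ i`), signs `s` and ranks `rk` such that the relator
`σ i`, inverted if `s i` and with all generators of rank `< rk i` erased, is conjugate (here: equal) to `x_i`.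

THE FAMILY.  The proof is split by topic into eight modules sharing this namespace (400-line bound on proof
files): `Theorems/RootDecompAEDoublesShadowLEOnePeel{Defs, Blocks, LocalTable, Table, LocalStep, Combine, Recursion}`
and this closing module; below, "§k" refers to the section headings of those modules.

TWINS.  `…PeelDefs` §1 repeats VERBATIM the skeleton-local definitions the statement is built from — the `Piece`
block (skeleton §2, l.114–188; sha256 of the copied text `459bd727…`), the `ShadowGraph` block (skeleton §3,
l.192–280; `b52ead42…`) and `PeelCertificates` itself (skeleton §7, l.695–703; `96feadb8…`) — inside this family's
namespace, followed by `example : PeelCertificates ↔ <its body> := Iff.rfl`.  The statement proved here is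
therefore syntactically the registered signature `PeelCertificates` over definitions that are textually those of
the skeleton.  ANTI-SHADOWING: no other constant of the family has last name component `PeelCertificates`; the only
theorem about it is `stub_peelCertificates` below.  Nothing in the family is an `instance`, a `notation` or a
`macro`; no `native_decide`; axioms are the standard three.

THE PROOF (determinant peeling).  Write `P(G)` over the letters `x_(v,i)` (two spine letters per piece) and `t_e`
(one stable letter per gluing); its relators are the gluing relators `w_src(e) · t_e · w_tgt(e)^{±1} · t_e⁻¹`, the
killing relators `t_e` of tree gluings and the killing relators `x_(v,i)` of unused spine letters (`rank v ≤ i`).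
* §2 Exponent sums.  `expo j : FreeGroup →* ℤ`; if the normal closure of the relators of a balanced presentation is
  everything, the square exponent matrix is unimodular over `ℤ` (`isUnit_det_expoMat`: the relator rows generate
  `ℤⁿ`, so the identity matrix factors through them).
* §3 Unimodular blocks `UM a rows cols` of an integer table indexed by finsets, and the two facts that drive the
  peeling: a block that is triangular with respect to a splitting of rows and columns is unimodular iff both diagonal
  blocks are (`UM.split_top`, `UM.split_bot`, from `Matrix.det_fromBlocks_zero₁₂/₂₁`), and rank bounds for rows /
  columns supported in few columns / rows (`UM.card_le_of_rows_supported`, `…_cols_supported`).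
* §4 THE LOCAL TABLE (★): for each of the twelve pieces (pair of pants, eleven figure-eight blocks), every single
  port word with unit exponent (rank one) IS the letter `a`, and every ordered pair of distinct port words whose
  `2 × 2` exponent matrix is unimodular is SIGNED TRIANGULAR: one of the two words, possibly inverted, is a letter,
  and the other, possibly inverted and with that letter erased, is the other letter (`localTable_rank_one`,
  `localTable_rank_two`; finitely many closed free-group identities, each checked by `decide`).
* §5 The tree of pieces: under `IsSpanningTree` with all gluings tree edges, `m + 1 = k`, distinct gluings join
  distinct pairs of pieces, the piece graph is a tree, and every sub-tree with `≥ 2` pieces has a leaf whose removal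
  leaves it connected (`exists_leaf`, from Mathlib's `SimpleGraph.IsTree`).
* §6 Substitution lemmas: evaluating a substitution on a gluing relator (`lift_gluingRelator`), and the exponent
  table entries of gluing relators (`expo_inl_gluingRelator`).
* §7 THE PEELING RECURSION `peel_rec` on states `(R, L)` (`R` a sub-tree still to peel, `L` the pieces already
  peeled to the bottom): if the block `rows(R, L) × cols(R)` of the exponent table is unimodular then the state has a
  CERTIFICATE (`Cert`: an injective owner map rows → used letters, ranks, signs, such that every row, signed and
  with the non-used letters and the letters ranked below its owner erased, equals its owner letter).  Peel a leaf `u`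
  of `R` with tree edge `δ` towards `R`; all other rows at `u` end in `L` (cap rows `S`).  The rank bounds give
  `#S ∈ {rank u, rank u − 1}`.  BOTTOM (`#S = rank u`): the block is lower block-triangular, `S × letters(u)` is
  unimodular, (★) certifies it, `u` joins `L` with its letters ranked LOWEST, and the rest is the state
  `(R ∖ u, L ∪ u)`.  TOP (`#S + 1 = rank u`): `(S ∪ δ) × letters(u)` is unimodular, (★) certifies it with the
  letters of `u` ranked HIGHEST (so the far end of `δ` is erased), and the rest is the state `(R ∖ u, L)`, whose rows
  avoid `u`.  `combine` merges the local data with the certificate of the rest.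
* §8 The unimodular start `um_top` (in `…PeelRecursion`): the full exponent table is unimodular (§2) and the
  one-letter killing relators form a permutation block on the non-used letters, so the block `gluing rows × used
  letters` is unimodular (§3).  THIS MODULE: step L0 (copied from the skeleton's proved §6.1) —
  `PresentsTrivialGroup` forces every gluing to be a tree edge (a non-tree stable letter would survive in `H₁`) — and
  the extraction: `stub_peelCertificates` runs `peel_rec` on the whole tree and extends the certificate by the
  one-letter relators (owners of their own letters, rank `0`).

Source of the construction: the encoding graphs and their uniform presentations are those typed in the skeleton
(after arXiv:1803.06713 §4.2); this file uses only the typed data and Mathlib.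
-/

open Function
open Literature.Topology.FourManifolds

set_option linter.dupNamespace false

noncomputable section

namespace Summit.SmoothPoincare4.SmoothPoincare4.Theorems.RootDecompAEDoublesShadowLEOneStubPeelCertificates

/-! ## §8 Step L0 (all gluings are tree edges), the unimodular start, and the extraction of `PeelCertificates` -/

namespace ShadowGraph

variable (G : ShadowGraph)

/-! ### Step L0 (copied from the skeleton, `Lines/grade_one_ac.lean` §6.1): non-tree edges carry a character onto ℤ -/

/-- The exponent-sum character of the stable letter `t_e`: `t_e ↦ 1 ∈ ℤ`, every other generator `↦ 0`
(written multiplicatively). -/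
def stableCharacter (e : Fin G.m) : FreeGroup G.Gen →* Multiplicative ℤ :=
  FreeGroup.lift fun g => if g = Sum.inr e then Multiplicative.ofAdd 1 else 1

/-- Port words contain no stable letter. -/
theorem stableCharacter_portWordAt (e : Fin G.m) (p : Fin G.k × ℕ) :
    G.stableCharacter e (G.portWordAt p) = 1 := by
  have h : (G.stableCharacter e).comp (G.embed p.1) = 1 := by
    refine FreeGroup.ext_hom _ _ fun i => ?_
    simp [stableCharacter, embed]
  change ((G.stableCharacter e).comp (G.embed p.1)) ((G.piece p.1).portWord p.2) = 1
  rw [h]; rfl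

/-- The stable letter `t_e` has exponent sum zero in every gluing relator. -/
theorem stableCharacter_gluingRelator (e e' : Fin G.m) :
    G.stableCharacter e (G.gluingRelator e') = 1 := by
  unfold gluingRelator
  split_ifs <;> simp [map_mul, map_inv, stableCharacter_portWordAt, mul_comm]

/-- The character `t_e ↦ 1` kills every relator of `P(G)` as soon as `e` is NOT a tree edge. -/
theorem stableCharacter_relator (e : Fin G.m) (he : G.tree e = false) (r : G.Rel) :
    G.stableCharacter e (G.relator r) = 1 := by
  rcases r with e' | ⟨e', he'⟩ | p
  · exact G.stableCharacter_gluingRelator e e'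
  · have hne : (Sum.inr e' : G.Gen) ≠ Sum.inr e := by
      intro h
      have : e' = e := Sum.inr_injective h
      rw [this] at he'
      simp [he] at he'
    simp [relator, stable, stableCharacter, hne]
  · simp [relator, stableCharacter]

/-- **Step L0 (tree lemma).**  If the uniform presentation `P(G)` of an encoding graph presents the trivial group,
then EVERY glued pair is a tree edge: otherwise the stable letter `t_e` of a non-tree gluing survives in `H₁` (the
character `t_e ↦ 1 ∈ ℤ` kills all relators).  No admissibility hypothesis is needed. -/
theorem tree_eq_true_of_presentsTrivialGroup {n : ℕ} (eg : G.Gen ≃ Fin n) (er : G.Rel ≃ Fin n)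
    (h : (G.presentation eg er).PresentsTrivialGroup) (e : Fin G.m) : G.tree e = true := by
  by_contra he
  have he' : G.tree e = false := by simpa using he
  -- transport the character to `FreeGroup (Fin n)`
  let ψ : FreeGroup (Fin n) →* Multiplicative ℤ := (G.stableCharacter e).comp (FreeGroup.map eg.symm)
  have hψmap : ∀ x : FreeGroup G.Gen, ψ (FreeGroup.map eg x) = G.stableCharacter e x := by
    intro x
    have hc : (ψ.comp (FreeGroup.map eg)) = G.stableCharacter e := by
      refine FreeGroup.ext_hom _ _ fun g => ?_
      simp [ψ]
    exact congrArg (fun φ : FreeGroup G.Gen →* Multiplicative ℤ => φ x) hc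
  have hrel : ∀ r ∈ Set.range (G.presentation eg er), FreeGroup.lift (fun i => ψ (FreeGroup.of i)) r = 1 := by
    rintro r ⟨j, rfl⟩
    have hl : FreeGroup.lift (fun i => ψ (FreeGroup.of i)) = ψ := by
      refine FreeGroup.ext_hom _ _ fun i => ?_
      simp
    rw [hl]
    show ψ (FreeGroup.map eg (G.relator (er.symm j))) = 1
    rw [hψmap]
    exact G.stableCharacter_relator e he' _
  -- the induced map on the (trivial) presented group sends `x_{eg (t_e)}` to `1 ∈ ℤ`, absurd
  have hsub : Subsingleton (PresentedGroup (Set.range (G.presentation eg er))) := h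
  have h1 : PresentedGroup.toGroup hrel (PresentedGroup.of (eg (Sum.inr e))) = ψ (FreeGroup.of (eg (Sum.inr e))) :=
    PresentedGroup.toGroup.of hrel
  have h2 : (PresentedGroup.of (eg (Sum.inr e)) : PresentedGroup (Set.range (G.presentation eg er))) = 1 :=
    Subsingleton.elim _ _
  rw [h2, map_one] at h1
  have h3 : ψ (FreeGroup.of (eg (Sum.inr e))) = Multiplicative.ofAdd (1 : ℤ) := by
    simp [ψ, stableCharacter]
  rw [h3] at h1
  exact absurd (Multiplicative.ofAdd.injective (h1.symm.trans rfl)) (by norm_num)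

end ShadowGraph

/-! ### The extraction -/

open ShadowGraph in
/-- **THE PEELING THEOREM** — the LOAD-BEARING registered stub `stub_peelCertificates` of the line `grade_one_ac`
(`Cruxes/DoublesShadowLEOne/Lines/grade_one_ac.lean`), proved by name: for every admissible KMN encoding graph
whose uniform presentation `P(G)` presents the trivial group, `P(G)` admits peeling certificates (a bijection
generators ↔ relators, signs and ranks such that each relator, signed and with the lower-ranked generators erased,
is conjugate to — here: equal to — its generator). -/
theorem stub_peelCertificates : PeelCertificates := by
  classical
  intro G n eg er hA hTriv
  obtain ⟨hV, hI, hT⟩ := hA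
  have hall : ∀ e, G.tree e = true := G.tree_eq_true_of_presentsTrivialGroup eg er hTriv
  have hself : ∀ e, (G.src e).1 ≠ (G.tgt e).1 := fun e => hT.1 e (hall e)
  obtain ⟨hmk, -, -⟩ := G.tree_facts hT hall
  -- the unimodular start and the peeling recursion on the whole tree
  have hU := G.um_top hall eg er hTriv
  have hk : (Finset.univ : Finset (Fin G.k)).card = (G.k - 1) + 1 := by
    rw [Finset.card_univ, Fintype.card_fin]; omega
  obtain ⟨lam, rk, sg, hinj, hmem, hlo, hval⟩ :=
    G.peel_rec hV hI hT hall (G.k - 1) Finset.univ ∅ hk (Finset.disjoint_empty_right _)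
      (G.induce_univ_connected hT) hU 1
  rw [rows_univ] at hinj hmem hval
  -- the owner map `Rel → Gen` and its bijectivity
  let owner : G.Rel → G.Gen := fun r => Sum.elim lam (fun x => G.ownLetter (Sum.inr x)) r
  have howner_inl : ∀ e, owner (Sum.inl e) = lam e := fun e => rfl
  have hlam_cols : ∀ e, lam e ∈ G.cols Finset.univ := fun e => hmem e (Finset.mem_univ e)
  have hinj_owner : Function.Injective owner := by
    intro r₁ r₂ heq
    rcases r₁ with e₁ | ⟨e₁, he₁⟩ | ⟨p₁, hp₁⟩ <;> rcases r₂ with e₂ | ⟨e₂, he₂⟩ | ⟨p₂, hp₂⟩ <;>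
      simp only [owner, Sum.elim_inl, Sum.elim_inr, ownLetter] at heq
    · exact congrArg Sum.inl (hinj e₁ (Finset.mem_univ _) e₂ (Finset.mem_univ _) heq)
    · exact absurd (heq ▸ hlam_cols e₁) (G.inr_not_mem_cols _ _)
    · exfalso
      have h := heq ▸ hlam_cols e₁
      rw [show p₂ = (p₂.1, p₂.2) from rfl, inl_mem_cols] at h
      exact absurd h.2 (not_lt.mpr hp₂)
    · exact absurd (heq.symm ▸ hlam_cols e₂) (G.inr_not_mem_cols _ _)
    · cases heq; rfl
    · cases heq
    · exfalso
      have h := heq.symm ▸ hlam_cols e₂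
      rw [show p₁ = (p₁.1, p₁.2) from rfl, inl_mem_cols] at h
      exact absurd h.2 (not_lt.mpr hp₁)
    · cases heq
    · simp only [Sum.inl.injEq] at heq
      cases (Subtype.ext heq : (⟨p₁, hp₁⟩ : {p : Fin G.k × Fin 2 // (G.piece p.1).rank ≤ (p.2 : ℕ)}) = ⟨p₂, hp₂⟩)
      rfl
  have hbij : Function.Bijective owner := by
    rw [Fintype.bijective_iff_injective_and_card]
    exact ⟨hinj_owner, (Fintype.card_congr er).trans (Fintype.card_congr eg).symm⟩
  let ω : G.Rel ≃ G.Gen := Equiv.ofBijective owner hbij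
  have hω : ∀ r, ω r = owner r := fun r => rfl
  -- ranks and signs
  let RK : G.Gen → ℕ := fun g => if g ∈ G.cols Finset.univ then rk g else 0
  let sR : G.Rel → Bool := fun r => Sum.elim sg (fun _ => false) r
  -- evaluation of the signed, erased relator `r` to its owner letter
  have hrel : ∀ r : G.Rel,
      sgnw (sR r) (FreeGroup.lift (fun g => if RK g < RK (owner r) then (1 : FreeGroup G.Gen) else FreeGroup.of g)
        (G.relator r)) = FreeGroup.of (owner r) := by
    intro r
    rcases r with e | ⟨e, he⟩ | ⟨p, hp⟩
    · -- a gluing relator: this is the certificate of the peeling recursion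
      have hcol := hlam_cols e
      have hrk1 : 1 ≤ rk (lam e) := hlo _ hcol
      have hF' : (fun g => if RK g < RK (owner (Sum.inl e)) then (1 : FreeGroup G.Gen) else FreeGroup.of g) =
          G.erase (G.cols Finset.univ) rk (lam e) := by
        funext g
        simp only [owner, Sum.elim_inl, erase, RK, if_pos hcol]
        by_cases hg : g ∈ G.cols Finset.univ
        · simp only [hg, not_true_eq_false, false_or, if_true]
        · rw [if_neg hg, if_pos (by omega), if_pos (Or.inl hg)]
      rw [hF', ← hom_sgnw]
      exact hval e (Finset.mem_univ e)
    · -- the killing relator of a stable letter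
      simp [sR, owner, ownLetter, relator, stable, sgnw]
    · -- the killing relator of an unused spine letter
      simp [sR, owner, ownLetter, relator, sgnw]
  -- the certificate for the generator `i = eg (owner r)`
  have key : ∀ i : Fin n,
      IsConj (FreeGroup.lift (fun j => if RK (eg.symm j) < RK (eg.symm i) then (1 : FreeGroup (Fin n)) else FreeGroup.of j)
        (if sR (ω.symm (eg.symm i)) then (G.presentation eg er (er (ω.symm (eg.symm i))))⁻¹
          else G.presentation eg er (er (ω.symm (eg.symm i))))) (FreeGroup.of i) := by
    intro i
    obtain ⟨r, hr⟩ : ∃ r, i = eg (owner r) :=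
      ⟨ω.symm (eg.symm i), by rw [← hω, Equiv.apply_symm_apply, Equiv.apply_symm_apply]⟩
    subst hr
    have hωr : ω.symm (owner r) = r := by rw [← hω r]; exact Equiv.symm_apply_apply ω r
    simp only [Equiv.symm_apply_apply, hωr]
    have hP : G.presentation eg er (er r) = FreeGroup.map eg (G.relator r) := by simp [presentation]
    have hF : ((fun j => if RK (eg.symm j) < RK (owner r) then (1 : FreeGroup (Fin n)) else FreeGroup.of j) ∘ ⇑eg) =
        ⇑(FreeGroup.map eg) ∘ fun g => if RK g < RK (owner r) then (1 : FreeGroup G.Gen) else FreeGroup.of g := by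
      funext g
      simp only [Function.comp_apply, Equiv.symm_apply_apply]
      split_ifs
      · exact (map_one _).symm
      · exact FreeGroup.map.of.symm
    rw [hP, ← sgnw_eq_ite, ← hom_sgnw (FreeGroup.map eg), lift_map_eq, hF, ← hom_lift_eq (FreeGroup.map eg),
      hom_sgnw, hrel r, FreeGroup.map.of]
  exact ⟨eg.symm.trans (ω.symm.trans er), fun i => sR (ω.symm (eg.symm i)), fun j => RK (eg.symm j),
    fun i => by simpa only [Equiv.trans_apply] using key i⟩

end Summit.SmoothPoincare4.SmoothPoincare4.Theorems.RootDecompAEDoublesShadowLEOneStubPeelCertificates
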